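import Summits.Ventures.CertifiedArithmetic.LowPrec.AccumulateSharp

/-!
# Recursive summation, ALL `n`: the Lange–Rump bound `((1+2u)ⁿ - 1)/((1+2u)ⁿ + 1) < 1`

HONEST FRAMING (venture CertifiedArithmetic / cell `pub-lowprec`): certified error envelopes and
provably optimal rounding/accumulation schemes for low-precision formats under stated cost models;
every table by two implementations; no hardware or vendor claims.

[LangeRump2018, Thm 10] (Lange–Rump, *Sharp estimates for perturbation errors in summations*,
Math. Comp. 88 (2019), §5): for RECURSIVE summation `s₁ = x₁`, `sₖ = fl(sₖ₋₁ + xₖ)` under the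
sole assumption `|δₖ| ≤ |xₖ|` on the local errors, with `ξₖ := |δₖ|/(Σ_{i≤k}|xᵢ| + Σ_{i<k}|δᵢ|)`
and `qₙ := Π (1-ξᵢ)/(1+ξᵢ)`: `|sₙ - Σxᵢ| ≤ Σ|δᵢ| ≤ (1-qₙ)/(1+qₙ) · Σ|xᵢ|` — valid for EVERY `n`,
always `< 1`, and sharp in the paper's perturbation model.

PROVED HERE for the venture's formats, in the uniform form obtained from `ξₖ ≤ u/(1+u)` (the sharp
relative error of one rounded addition, `AccumulateSharp.lean`), i.e. `qₙ ≥ (1+2u)^{-n}`: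
for `x 0 … x n` values of `α` (`emaxCode ≥ 2`), every step in range, `n` additions, NO restriction
on `n`:
  `|ŝₙ - Σ_{i≤n} xᵢ| ≤ (rⁿ - 1)/(rⁿ + 1) · Σ_{i≤n} |xᵢ|`,  `r = 1 + 2u`
(`abs_seqSum_sub_sum_le_allN`). The factor is `< 1` for every `n` (`langeRump_allN_factor_lt_one`),
`≤ n·u/(1+u)` (so never worse than Jeannerod–Rump), and for `n ≤ ½u⁻¹` weaker than the sharp
`n u/(1+n u)` of `AccumulateLangeRump.lean`; its point is the range `n > u⁻¹` where
`(n-1)u/(1+u) ≥ 1` is vacuous: e.g. bfloat16, `n = 1000` additions: factor `≤ 0.9992`.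
The proof is the paper's two-case induction ((32)/(34)) run on `|ŝₙ - sₙ|` directly.

Not here: the data-dependent `qₙ` form and its sharpness (35); faithful rounding.
-/

namespace Literature.ComputerArithmetic.FloatingPoint

namespace MiniFloat

open Finset

variable {α : Format}

/-- The all-`n` factor `φₙ = (rⁿ - 1)/(rⁿ + 1)`, `r = 1 + 2u`. [cite: LangeRump2018, Thm 10] -/
noncomputable def langeRumpAllN (α : Format) (n : ℕ) : ℚ :=
  ((1 + 2 * α.unitRoundoff) ^ n - 1) / ((1 + 2 * α.unitRoundoff) ^ n + 1)

/-- `φₙ < 1`. [cite: LangeRump2018, Thm 10] -/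
theorem langeRumpAllN_lt_one (α : Format) (n : ℕ) : langeRumpAllN α n < 1 := by
  unfold langeRumpAllN
  have hr : (0 : ℚ) < (1 + 2 * α.unitRoundoff) ^ n := pow_pos (by linarith [α.unitRoundoff_pos]) n
  rw [div_lt_one (by linarith)]
  linarith

/-- `0 ≤ φₙ`. [folklore] -/
theorem langeRumpAllN_nonneg (α : Format) (n : ℕ) : 0 ≤ langeRumpAllN α n := by
  unfold langeRumpAllN
  have hr : (1 : ℚ) ≤ (1 + 2 * α.unitRoundoff) ^ n := one_le_pow₀ (by linarith [α.unitRoundoff_pos])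
  exact div_nonneg (by linarith) (by linarith)

/-- The recursion behind the induction: with `ū = u/(1+u)`,
`ū + (1 + ū)·(r^n - 1)/(r^(n+1) + 1) = φₙ₊₁` and `1 - φₙ = 2/(rⁿ + 1)`. [cite: LangeRump2018, Thm 10] -/
theorem langeRumpAllN_succ_identity (α : Format) (n : ℕ) :
    α.unitRoundoff / (1 + α.unitRoundoff)
        + (1 + α.unitRoundoff / (1 + α.unitRoundoff))
          * (((1 + 2 * α.unitRoundoff) ^ n - 1) / ((1 + 2 * α.unitRoundoff) ^ (n + 1) + 1))
      = langeRumpAllN α (n + 1) := by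
  unfold langeRumpAllN
  have hu := α.unitRoundoff_pos
  have hr : (0 : ℚ) < (1 + 2 * α.unitRoundoff) ^ n := pow_pos (by linarith) n
  rw [pow_succ]
  field_simp
  ring

/-- LANGE–RUMP, RECURSIVE SUMMATION, EVERY `n` [LangeRump2018, Thm 10, uniform form]: inputs
`x 0 … x n` values of `α` (`emaxCode ≥ 2`), every step in range ⟹
`|ŝₙ - Σ_{i≤n} xᵢ| ≤ (rⁿ - 1)/(rⁿ + 1) · Σ_{i≤n}|xᵢ|`, `r = 1 + 2u`, with NO restriction on `n`.
[cite: LangeRump2018, Thm 10] -/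
theorem abs_seqSum_sub_sum_le_allN (hα : 2 ≤ α.emaxCode) (x : ℕ → ℚ) :
    ∀ n : ℕ, (∀ i ≤ n, ∃ y : MiniFloat α, y.toRat = x i) → InRange α x n →
      |(seqSum α x n).toRat - ∑ i ∈ range (n + 1), x i|
        ≤ langeRumpAllN α n * ∑ i ∈ range (n + 1), |x i|
  | 0, hx, _ => by
      simp only [seqSum, zero_add, range_one, sum_singleton]
      rw [toRat_roundNE_of_exists (hx 0 le_rfl), sub_self, abs_zero]
      exact mul_nonneg (langeRumpAllN_nonneg α 0) (abs_nonneg _)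
  | n + 1, hx, hr => by
      have hu := α.unitRoundoff_pos
      set u := α.unitRoundoff with hu_def
      set ub := u / (1 + u) with hub
      have hub0 : 0 ≤ ub := div_nonneg hu.le (by linarith)
      -- previous step
      have hx' : ∀ i ≤ n, ∃ y : MiniFloat α, y.toRat = x i := fun i hi => hx i (Nat.le_succ_of_le hi)
      have hr' : InRange α x n := ⟨hr.1, fun k hk => hr.2 k (Nat.lt_succ_of_lt hk)⟩
      have ih := abs_seqSum_sub_sum_le_allN hα x n hx' hr'
      set E := |(seqSum α x n).toRat - ∑ i ∈ range (n + 1), x i| with hE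
      set T := ∑ i ∈ range (n + 1), |x i| with hT
      have hT0 : 0 ≤ T := sum_nonneg fun i _ => abs_nonneg _
      -- the new step: ŝ' = fl(ŝ + x'), local error d
      obtain ⟨y, hy⟩ := hx (n + 1) le_rfl
      have hrange : |(seqSum α x n).toRat + y.toRat| ≤ α.maxRat := by rw [hy]; exact hr.2 n (by omega)
      set d := (roundNE α ((seqSum α x n).toRat + x (n + 1))).toRat
        - ((seqSum α x n).toRat + x (n + 1)) with hd
      have hd1 : |d| ≤ |x (n + 1)| := by
        have := abs_err_roundNE_add_le_abs (seqSum α x n) y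
        rw [hy] at this; exact this
      have hd2 : |d| ≤ ub * |(seqSum α x n).toRat + x (n + 1)| := by
        have := abs_err_roundNE_add_le_sharp hα (seqSum α x n) y hrange
        rw [hy] at this; exact this
      -- bookkeeping
      rw [sum_range_succ, sum_range_succ (fun i => |x i|)]
      have hstep : (seqSum α x (n + 1)).toRat - (∑ i ∈ range (n + 1), x i + x (n + 1))
          = ((seqSum α x n).toRat - ∑ i ∈ range (n + 1), x i) + d := by
        simp only [seqSum, hd]; ring
      rw [hstep]
      have harg : |(seqSum α x n).toRat + x (n + 1)| ≤ T + E + |x (n + 1)| := by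
        have h1 : |∑ i ∈ range (n + 1), x i| ≤ T := abs_sum_le_sum_abs _ _
        calc |(seqSum α x n).toRat + x (n + 1)|
            = |((seqSum α x n).toRat - ∑ i ∈ range (n + 1), x i) + ∑ i ∈ range (n + 1), x i
                + x (n + 1)| := by ring_nf
          _ ≤ |((seqSum α x n).toRat - ∑ i ∈ range (n + 1), x i) + ∑ i ∈ range (n + 1), x i|
                + |x (n + 1)| := abs_add_le _ _
          _ ≤ E + T + |x (n + 1)| := by
              have := abs_add_le ((seqSum α x n).toRat - ∑ i ∈ range (n + 1), x i)
                (∑ i ∈ range (n + 1), x i)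
              linarith
          _ = T + E + |x (n + 1)| := by ring
      have hEtot : |((seqSum α x n).toRat - ∑ i ∈ range (n + 1), x i) + d| ≤ E + |d| :=
        abs_add_le _ _
      -- constants
      set rn := (1 + 2 * u) ^ n with hrn
      have hrn1 : 1 ≤ rn := one_le_pow₀ (by linarith)
      have hphi_n : langeRumpAllN α n = (rn - 1) / (rn + 1) := rfl
      have hphi_s : langeRumpAllN α (n + 1) = (rn * (1 + 2 * u) - 1) / (rn * (1 + 2 * u) + 1) := by
        unfold langeRumpAllN; rw [pow_succ]
      have hid := langeRumpAllN_succ_identity α n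
      rw [← hub, pow_succ, ← hrn] at hid
      have hden1 : 0 < rn + 1 := by linarith
      have hden2 : 0 < rn * (1 + 2 * u) + 1 := by nlinarith
      set X := |x (n + 1)| with hX
      have hX0 : 0 ≤ X := abs_nonneg _
      by_cases hcase : 2 / (rn * (1 + 2 * u) + 1) * (T + X) ≤ 2 / (rn + 1) * T
      · -- case (32): use |d| ≤ |x'|
        have h1 : E + |d| ≤ X + (rn - 1) / (rn + 1) * T := by rw [hphi_n] at ih; linarith
        have h2 : X + (rn - 1) / (rn + 1) * T = (T + X) - 2 / (rn + 1) * T := by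
          field_simp; ring
        have h3 : langeRumpAllN α (n + 1) * (T + X)
            = (T + X) - 2 / (rn * (1 + 2 * u) + 1) * (T + X) := by
          rw [hphi_s]; field_simp; ring
        calc |((seqSum α x n).toRat - ∑ i ∈ range (n + 1), x i) + d| ≤ E + |d| := hEtot
          _ ≤ (T + X) - 2 / (rn + 1) * T := by rw [← h2]; exact h1
          _ ≤ (T + X) - 2 / (rn * (1 + 2 * u) + 1) * (T + X) := by linarith
          _ = langeRumpAllN α (n + 1) * (T + X) := h3.symm
      · -- case (34): use |d| ≤ ū |ŝ + x'| ≤ ū (T + X + E)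
        have hc : 2 / (rn + 1) * T < 2 / (rn * (1 + 2 * u) + 1) * (T + X) := not_le.mp hcase
        -- T < (rn + 1)/(rn(1+2u) + 1) · (T + X)
        have hT' : T ≤ (rn + 1) / (rn * (1 + 2 * u) + 1) * (T + X) := by
          have e1 : (rn + 1) / 2 * (2 / (rn + 1) * T) = T := by
            field_simp
          have e2 : (rn + 1) / 2 * (2 / (rn * (1 + 2 * u) + 1) * (T + X))
              = (rn + 1) / (rn * (1 + 2 * u) + 1) * (T + X) := by
            field_simp
          have := mul_lt_mul_of_pos_left hc (by positivity : (0 : ℚ) < (rn + 1) / 2)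
          rw [e1, e2] at this
          exact this.le
        have h1 : E + |d| ≤ ub * (T + X) + (1 + ub) * E := by
          have := le_trans hd2 (mul_le_mul_of_nonneg_left harg hub0)
          nlinarith
        have hphi0 := langeRumpAllN_nonneg α n
        have h2 : (1 + ub) * E ≤ (1 + ub) * ((rn - 1) / (rn + 1) * T) :=
          mul_le_mul_of_nonneg_left (by rw [hphi_n] at ih; exact ih) (by linarith)
        have h3 : (rn - 1) / (rn + 1) * T
            ≤ (rn - 1) / (rn + 1) * ((rn + 1) / (rn * (1 + 2 * u) + 1) * (T + X)) :=
          mul_le_mul_of_nonneg_left hT' (by rw [← hphi_n]; exact hphi0)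
        have h4 : (rn - 1) / (rn + 1) * ((rn + 1) / (rn * (1 + 2 * u) + 1) * (T + X))
            = (rn - 1) / (rn * (1 + 2 * u) + 1) * (T + X) := by
          field_simp
        calc |((seqSum α x n).toRat - ∑ i ∈ range (n + 1), x i) + d| ≤ E + |d| := hEtot
          _ ≤ ub * (T + X) + (1 + ub) * ((rn - 1) / (rn * (1 + 2 * u) + 1) * (T + X)) := by
              have := mul_le_mul_of_nonneg_left (le_trans h3 (le_of_eq h4)) (by linarith : (0:ℚ) ≤ 1 + ub)
              linarith
          _ = (ub + (1 + ub) * ((rn - 1) / (rn * (1 + 2 * u) + 1))) * (T + X) := by ring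
          _ = langeRumpAllN α (n + 1) * (T + X) := by rw [hid]

/-- The factor never exceeds Jeannerod–Rump's `n·u/(1+u)` ([LangeRump2018, (31)] with `ξᵢ ≤ ū`).
[cite: LangeRump2018, Thm 10] -/
theorem langeRumpAllN_le_mul (α : Format) (n : ℕ) :
    langeRumpAllN α n ≤ (n : ℚ) * (α.unitRoundoff / (1 + α.unitRoundoff)) := by
  induction n with
  | zero => simp [langeRumpAllN]
  | succ n ih =>
      have hu := α.unitRoundoff_pos
      rw [← langeRumpAllN_succ_identity α n]
      have hr : (1 : ℚ) ≤ (1 + 2 * α.unitRoundoff) ^ n := one_le_pow₀ (by linarith)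
      have hub1 : α.unitRoundoff / (1 + α.unitRoundoff) ≤ 1 := by
        rw [div_le_one (by linarith)]; linarith
      have hub0 : 0 ≤ α.unitRoundoff / (1 + α.unitRoundoff) := div_nonneg hu.le (by linarith)
      -- (1+ū)(rⁿ-1)/(rⁿ⁺¹+1) ≤ (rⁿ-1)/(rⁿ+1) = φₙ ≤ n ū
      have h1 : ((1 + 2 * α.unitRoundoff) ^ n - 1) / ((1 + 2 * α.unitRoundoff) ^ (n + 1) + 1)
          * (1 + α.unitRoundoff / (1 + α.unitRoundoff)) ≤ langeRumpAllN α n := by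
        unfold langeRumpAllN
        set ub := α.unitRoundoff / (1 + α.unitRoundoff) with hub
        set rn := (1 + 2 * α.unitRoundoff) ^ n with hrn
        rw [div_mul_eq_mul_div, div_le_div_iff₀ (by positivity) (by positivity), pow_succ]
        have k1 : ub ≤ α.unitRoundoff := by
          rw [hub, div_le_iff₀ (by linarith)]; nlinarith
        have k2 : ub * rn ≤ α.unitRoundoff * rn := mul_le_mul_of_nonneg_right k1 (by linarith)
        have k3 : α.unitRoundoff ≤ α.unitRoundoff * rn := by nlinarith
        have k4 : (1 + ub) * (rn + 1) ≤ rn * (1 + 2 * α.unitRoundoff) + 1 := by nlinarith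
        have k5 := mul_le_mul_of_nonneg_left k4 (by linarith : (0 : ℚ) ≤ rn - 1)
        calc (rn - 1) * (1 + ub) * (rn + 1) = (rn - 1) * ((1 + ub) * (rn + 1)) := by ring
          _ ≤ (rn - 1) * (rn * (1 + 2 * α.unitRoundoff) + 1) := k5
      push_cast
      linarith

/-- bfloat16 illustration (`u = 2^-8`): at `n = 256 = u⁻¹` additions the Jeannerod–Rump factor
`n u/(1+u) = 256/257` is about to become vacuous while the all-`n` factor is
`(r^256 - 1)/(r^256 + 1)` with `r = 1 + 2^-7`; the inequality `φ₂₅₆ ≤ 256·u/(1+u) < 1` is an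
instance of the two lemmas above. [cite: LangeRump2018, Thm 10] -/
theorem langeRumpAllN_BFloat16_256 :
    langeRumpAllN Format.BFloat16 256 ≤ (256 : ℚ) * (Format.BFloat16.unitRoundoff
      / (1 + Format.BFloat16.unitRoundoff)) ∧ langeRumpAllN Format.BFloat16 256 < 1 :=
  ⟨by exact_mod_cast langeRumpAllN_le_mul Format.BFloat16 256, langeRumpAllN_lt_one _ _⟩

end MiniFloat

end Literature.ComputerArithmetic.FloatingPoint
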